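import Summits.AtomisticToContinuum.Crystallization.Theorems.ChartedPlanarOrderBarlowGluing

/-!
# (B′.7c) ZZZI — BARLOW GLUING AT THE SHADOW DIALS `(1/15, 8999/10000, 103/100)`, part 1: charts, transfer, two steps (5 theorems, 0 def)

Lineage `stmt-AtomisticToContinuum-26636` (route ChartedPlanarOrder), lens-2 g82; piece (CC) `PlacedCrystalChartP` of ZZZG.  A two-sided
`(10⁻⁴, 5)`-shadow of a clean (`(1/16, 9/10, 1)`-good) crystal is `(1/15, 8999/10000, 1)`-good (ZZZH `isTwoShellGoodSet_of_envClose_record`) —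
OUTSIDE the hard-coded dials `(1/16, 9/10, 103/100)` of lens-3's `ChartedPlanarOrderBarlowGluing.barlowGluingW_holds`, by `10⁻⁴` in the lower scale
and `1/240` in the tolerance.  This file and its sequel ZZZJ PORT lens-3's parts II §4 / III (`…BarlowGluingCharts`, `…BarlowGluing`) to the dials
`(1/15, 8999/10000, 103/100)` (a window containing both lens-3's and the shadow's): the SAME proofs, with the two-step radius `27/20 = (3/2)·(9/10)`
replaced by `134/100 ≤ (3/2)·(8999/10000)` and the numerical margins re-checked — first shell `16a/15 ≤ 1.0987 ≤ 28/25`; second shell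
`≥ a√2 − a/15 ≥ 1.2039 > 6/5`; links `a√2 − 2a/15 ≥ 1.135 > 28/25` and `17a/15 ≤ 1.168 < 6/5`; closeness at the common scale `b = 193/200`:
`a/15 + |a − b| ≤ 0.134 ≤ b/5`; direction cosine `0.8999/1.4143 − 1.03/15 ≥ 0.567 ≥ 139/250`.

* `annulus`, `two_step`, `intChart` — lens-3 part II §4 verbatim at the new dials (radius `134/100` in `two_step`);
* `charts`, `loc_walk` — lens-3 part III §1 verbatim at the new dials.

No new idea (credit: lens-3 `ChartedPlanarOrderBarlowGluing{Charts,}`; [HalesDSP2012, §1.3]; [ConwaySloane1999, Ch. 4 §6.3]); 0 sorry; no def, no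
instance, no notation (the `local notation "E3"` line is lens-3's, file-local).
-/

noncomputable section

namespace Summit.AtomisticToContinuum.Crystallization.Theorems.ChartedZeroExcessLayeredLatticeLiouville.ShadowGluing

open Literature.Geometry.DiscreteGeometry
open Summit.AtomisticToContinuum.Crystallization.Theorems.PalmUnimodularRigidityShellsToBarlowChart
open Summit.AtomisticToContinuum.Crystallization.Theorems.ChartedPlanarOrderBarlowGluingCharts (mem_scaledPattern_eighteen dist_scaled
  twoShell_labels dist_center_ideal dist_ideal_ideal dist_center_bounds dist_pair_bounds)
open Metric

local notation "E3" => EuclideanSpace ℝ (Fin 3)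

/-! ## §1 The integer chart at a good site (lens-3 part II §4 at the shadow dials) -/

/-- **The empty annulus.**  In an all-good set two distinct points at distance `≤ 6/5` are bonded
(distance `≤ 28/25`): read off the two-shell pattern of either point, a neighbour within `3a/2` is a
first-shell image (distance `≤ 17a/16 ≤ 1.0944`) or a second-shell image (distance `≥ (√2 − 1/16)a > 6/5`).
[cite: HalesDSP2012, §1.3] -/
theorem annulus {Y : Set E3} (hY : ∀ q ∈ Y, IsTwoShellGoodSet (1 / 15) (8999 / 10000) (103 / 100) Y q)
    {p q : E3} (hp : p ∈ Y) (hq : q ∈ Y) (hpq : p ≠ q) (hd : dist p q ≤ 6 / 5) : dist p q ≤ 28 / 25 := by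
  obtain ⟨a, ha9, ha1, A, P, f, hP, hf, -, hsurj⟩ := hY p hp
  have ha0 : 0 ≤ a := by linarith
  have ha2 : 8999 / 10000 * (14142 / 10000) ≤ a * Real.sqrt 2 := mul_le_mul ha9 ChartedPlanarOrderStackedLayerGeometry.sqrt_two_bounds.1.le (by norm_num) ha0
  obtain ⟨u, hu, hfu⟩ := hsurj q hq hpq.symm (by rw [dist_comm]; linarith)
  have hb := dist_center_bounds ha0 (hf u hu).2
  rw [hfu] at hb
  obtain ⟨L, -, -, hLn, hPL, -⟩ := twoShell_labels hP
  rcases hPL u hu with ⟨s, hs, hsu⟩ | hn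
  · have hn1 : ‖u‖ = 1 := by rw [← hsu]; exact hLn s hs
    rw [hn1] at hb
    linarith [hb.2]
  · rw [hn] at hb
    linarith [hb.1]

/-- **Two steps reach the `27/20`-ball.**  In an all-good set, a point `z ≠ x` within `134/100 ≤ 3a/2` of `x`
is bonded to `x` (first shell) or to a first-shell neighbour of `x` (second shell: every second-shell
vector of either pattern is at distance `1` from a kissing vector, and the two images are then within
`9a/8 ≤ 6/5`, hence bonded by `annulus`). [cite: HalesDSP2012, §1.3] -/
theorem two_step {Y : Set E3} (hY : ∀ q ∈ Y, IsTwoShellGoodSet (1 / 15) (8999 / 10000) (103 / 100) Y q)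
    {x z : E3} (hx : x ∈ Y) (hz : z ∈ Y) (hxz : x ≠ z) (hd : dist x z ≤ 134 / 100) :
    (0 < dist x z ∧ dist x z ≤ 28 / 25) ∨
      ∃ y ∈ Y, (0 < dist x y ∧ dist x y ≤ 28 / 25) ∧ (0 < dist y z ∧ dist y z ≤ 28 / 25) := by
  obtain ⟨a, ha9, ha1, A, P, f, hP, hf, hinj, hsurj⟩ := hY x hx
  have ha0 : 0 ≤ a := by linarith
  obtain ⟨L, -, hLP, hLn, -, -, -, hL1⟩ := twoShell_labels hP
  obtain ⟨v, hv, rfl⟩ := hsurj z hz hxz.symm (by rw [dist_comm]; linarith)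
  obtain ⟨t, ht, h⟩ := hL1 v hv
  have hbt : 0 < dist x (f ((Real.sqrt 18)⁻¹ • intVec t)) ∧ dist x (f ((Real.sqrt 18)⁻¹ • intVec t)) ≤ 28 / 25 := by
    have hb := dist_center_bounds ha0 (hf _ (hLP t ht)).2
    rw [hLn t ht] at hb
    constructor <;> linarith [hb.1, hb.2]
  rcases h with hv' | hd1
  · left
    rw [← hv']
    exact hbt
  · right
    refine ⟨f ((Real.sqrt 18)⁻¹ • intVec t), (hf _ (hLP t ht)).1, hbt, ?_⟩
    have hne : f ((Real.sqrt 18)⁻¹ • intVec t) ≠ f v := fun h => by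
      have h' : ((Real.sqrt 18)⁻¹ • intVec t : E3) = v := hinj (hLP t ht) hv h
      rw [h', dist_self] at hd1
      exact zero_ne_one hd1
    have hpb := dist_pair_bounds ha0 (hf _ (hLP t ht)).2 (hf v hv).2
    rw [dist_comm ((Real.sqrt 18)⁻¹ • intVec t : E3) v, hd1] at hpb
    exact ⟨dist_pos.2 hne, annulus hY (hf _ (hLP t ht)).1 (hf v hv).1 hne (by linarith [hpb.2])⟩

/-- **Integer chart at a site of an all-good set.**  If every point of `Y` is
`(1/15, 8999/10000, 103/100)`-two-shell-good, then at each `x ∈ Y` there are labels `L ∈ {fcc3Int, hcpInt}` and a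
labelling `nb` of the `(0, 28/25]`-bonded neighbours of `x`, bijective on `L`, each `nb t` within `b/5` of
`x + b·A(t/√18)` for some linear isometry `A` at the common scale `b = 193/200`, with exact links
(`nb t ~ nb t'` iff `|t − t'|² = 18`), and for every direction `d` a label `t` with
`⟪nb t − x, d⟫ ≥ (139/250)‖d‖`. [cite: HalesDSP2012, §1.3; ConwaySloane1999, Ch. 4 §6.3] -/
theorem intChart {Y : Set E3} (hY : ∀ q ∈ Y, IsTwoShellGoodSet (1 / 15) (8999 / 10000) (103 / 100) Y q)
    {x : E3} (hx : x ∈ Y) :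
    ∃ (L : Finset (Fin 3 → ℤ)) (nb : (Fin 3 → ℤ) → E3), (L = fcc3Int ∨ L = hcpInt) ∧
      Set.BijOn nb ↑L {y | y ∈ Y ∧ (0 < dist x y ∧ dist x y ≤ 28 / 25)} ∧
      (∃ A : E3 →ₗᵢ[ℝ] E3, ∀ t ∈ L,
        dist (nb t) (x + ((193 / 200 : ℝ) * (Real.sqrt 18)⁻¹) • A (intVec t)) ≤ (193 / 200 : ℝ) / 5) ∧
      (∀ t ∈ L, ∀ t' ∈ L, ((0 < dist (nb t) (nb t') ∧ dist (nb t) (nb t') ≤ 28 / 25) ↔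
        sqNormInt (t - t') = 18)) ∧
      (∀ d : E3, ∃ t ∈ L, (139 : ℝ) / 250 * ‖d‖ ≤ inner ℝ (nb t - x) d) := by
  obtain ⟨a, ha9, ha1, A, P, f, hP, hf, hinj, hsurj⟩ := hY x hx
  obtain ⟨L, hL, hLP, hLn, hPL, hLd, hcov, -⟩ := twoShell_labels hP
  have ha0 : 0 ≤ a := by linarith
  have hs2 := ChartedPlanarOrderStackedLayerGeometry.sqrt_two_bounds
  have ha2 : 8999 / 10000 * (14142 / 10000) ≤ a * Real.sqrt 2 := mul_le_mul ha9 hs2.1.le (by norm_num) ha0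
  -- distances from the centre: first shell bonded, second shell beyond `6/5`
  have hnear : ∀ t ∈ L, 0 < dist x (f ((Real.sqrt 18)⁻¹ • intVec t)) ∧ dist x (f ((Real.sqrt 18)⁻¹ • intVec t)) ≤ 28 / 25 := by
    intro t ht
    have hb := dist_center_bounds ha0 (hf _ (hLP t ht)).2
    rw [hLn t ht] at hb
    constructor <;> linarith [hb.1, hb.2]
  have hfar : ∀ v ∈ P, ‖v‖ = Real.sqrt 2 → 6 / 5 < dist x (f v) := by
    intro v hv hn
    have hb := (dist_center_bounds ha0 (hf v hv).2).1
    rw [hn] at hb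
    linarith
  refine ⟨L, fun t => f ((Real.sqrt 18)⁻¹ • intVec t), hL, ⟨?_, ?_, ?_⟩, ⟨A, ?_⟩, ?_, ?_⟩
  · -- maps into the bonded neighbours
    intro t ht
    exact ⟨(hf _ (hLP t ht)).1, hnear t ht⟩
  · -- injective
    intro t ht t' ht' h
    exact scale18_injective (hinj (hLP t ht) (hLP t' ht') h)
  · -- onto the bonded neighbours
    rintro y ⟨hy, hpos, hle⟩
    have hyx : y ≠ x := fun h => by rw [h, dist_self] at hpos; exact lt_irrefl _ hpos
    obtain ⟨v, hv, rfl⟩ := hsurj y hy hyx (by rw [dist_comm]; linarith)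
    rcases hPL v hv with ⟨t, ht, htv⟩ | hn
    · exact ⟨t, ht, by show f ((Real.sqrt 18)⁻¹ • intVec t) = f v; rw [htv]⟩
    · exact absurd hle (not_le.2 (by linarith [hfar v hv hn]))
  · -- closeness at the common scale `b = 193/200`
    intro t ht
    have e : x + ((193 / 200 : ℝ) * (Real.sqrt 18)⁻¹) • A (intVec t) = x + (193 / 200 : ℝ) • A ((Real.sqrt 18)⁻¹ • intVec t) := by
      simp only [map_smul, smul_smul]
    rw [e]
    have h1 := (hf _ (hLP t ht)).2
    have h2 : dist (x + a • A ((Real.sqrt 18)⁻¹ • intVec t)) (x + (193 / 200 : ℝ) • A ((Real.sqrt 18)⁻¹ • intVec t)) = |a - 193 / 200| := by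
      rw [dist_eq_norm, add_sub_add_left_eq_sub, ← sub_smul, norm_smul, Real.norm_eq_abs, A.norm_map,
        hLn t ht, mul_one]
    have h3 := dist_triangle (f ((Real.sqrt 18)⁻¹ • intVec t)) (x + a • A ((Real.sqrt 18)⁻¹ • intVec t)) (x + (193 / 200 : ℝ) • A ((Real.sqrt 18)⁻¹ • intVec t))
    rw [h2] at h3
    rcases le_total a (193 / 200) with hab | hab
    · rw [abs_of_nonpos (by linarith)] at h3
      show dist (f ((Real.sqrt 18)⁻¹ • intVec t)) (x + (193 / 200 : ℝ) • A ((Real.sqrt 18)⁻¹ • intVec t)) ≤ 193 / 200 / 5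
      linarith
    · rw [abs_of_nonneg (by linarith)] at h3
      show dist (f ((Real.sqrt 18)⁻¹ • intVec t)) (x + (193 / 200 : ℝ) • A ((Real.sqrt 18)⁻¹ • intVec t)) ≤ 193 / 200 / 5
      linarith
  · -- exact links
    intro t ht t' ht'
    have hpb := dist_pair_bounds ha0 (hf _ (hLP t ht)).2 (hf _ (hLP t' ht')).2
    constructor
    · rintro ⟨hpos, hle⟩
      have hne : t ≠ t' := by
        rintro rfl
        rw [dist_self] at hpos
        exact lt_irrefl _ hpos
      rcases hLd t ht t' ht' hne with h1 | h1
      · exact (dist_scale18_eq_one_iff t t').1 h1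
      · exfalso
        have : a * Real.sqrt 2 ≤ a * dist ((Real.sqrt 18)⁻¹ • intVec t : E3) ((Real.sqrt 18)⁻¹ • intVec t') := mul_le_mul_of_nonneg_left h1 ha0
        have h' : dist (f ((Real.sqrt 18)⁻¹ • intVec t)) (f ((Real.sqrt 18)⁻¹ • intVec t')) ≤ 28 / 25 := hle
        linarith [hpb.1]
    · intro h18
      have h1 : dist ((Real.sqrt 18)⁻¹ • intVec t : E3) ((Real.sqrt 18)⁻¹ • intVec t') = 1 := (dist_scale18_eq_one_iff t t').2 h18
      have hne : ((Real.sqrt 18)⁻¹ • intVec t : E3) ≠ (Real.sqrt 18)⁻¹ • intVec t' := fun h => by rw [h, dist_self] at h1; exact zero_ne_one h1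
      have hfne : f ((Real.sqrt 18)⁻¹ • intVec t) ≠ f ((Real.sqrt 18)⁻¹ • intVec t') := fun h => hne (hinj (hLP t ht) (hLP t' ht') h)
      refine ⟨dist_pos.2 hfne, ?_⟩
      have hup : dist (f ((Real.sqrt 18)⁻¹ • intVec t)) (f ((Real.sqrt 18)⁻¹ • intVec t')) ≤ 1168 / 1000 := by
        rw [h1] at hpb
        linarith [hpb.2]
      -- the upper bound `≤ 28/25` is read off the NEIGHBOUR's own two-shell pattern (`annulus`)
      exact annulus hY (hf _ (hLP t ht)).1 (hf _ (hLP t' ht')).1 hfne (by linarith)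
  · -- a bonded neighbour in every direction
    intro d
    obtain ⟨u, hu⟩ : ∃ u : E3, A u = d := by
      obtain ⟨u, hu⟩ := (A.toLinearIsometryEquiv rfl).surjective d
      exact ⟨u, by simpa using hu⟩
    obtain ⟨t, ht, hcos⟩ := hcov u
    refine ⟨t, ht, ?_⟩
    have hvY := hf _ (hLP t ht)
    have hsplit : inner ℝ (f ((Real.sqrt 18)⁻¹ • intVec t) - x) d =
        a * inner ℝ u ((Real.sqrt 18)⁻¹ • intVec t : E3) + inner ℝ (f ((Real.sqrt 18)⁻¹ • intVec t) - (x + a • A ((Real.sqrt 18)⁻¹ • intVec t))) d := by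
      rw [← hu, show f ((Real.sqrt 18)⁻¹ • intVec t) - x = a • A ((Real.sqrt 18)⁻¹ • intVec t) + (f ((Real.sqrt 18)⁻¹ • intVec t) - (x + a • A ((Real.sqrt 18)⁻¹ • intVec t))) by abel, inner_add_left,
        real_inner_smul_left, A.inner_map_map, real_inner_comm u ((Real.sqrt 18)⁻¹ • intVec t : E3)]
    have herr : |inner ℝ (f ((Real.sqrt 18)⁻¹ • intVec t) - (x + a • A ((Real.sqrt 18)⁻¹ • intVec t))) d| ≤ 1 / 15 * a * ‖d‖ := by
      refine (abs_real_inner_le_norm _ _).trans ?_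
      rw [← dist_eq_norm]
      exact mul_le_mul_of_nonneg_right hvY.2 (norm_nonneg _)
    have hnu : ‖u‖ = ‖d‖ := by rw [← hu, A.norm_map]
    rw [hnu] at hcos
    have hd0 : 0 ≤ ‖d‖ := norm_nonneg _
    have hI0 : 0 ≤ inner ℝ u ((Real.sqrt 18)⁻¹ • intVec t : E3) := by
      by_contra h
      have : Real.sqrt 2 * inner ℝ u ((Real.sqrt 18)⁻¹ • intVec t : E3) < 0 :=
        mul_neg_of_pos_of_neg (by linarith [hs2.1]) (not_le.1 h)
      linarith
    have hI : ‖d‖ ≤ 14143 / 10000 * inner ℝ u ((Real.sqrt 18)⁻¹ • intVec t : E3) :=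
      hcos.trans (mul_le_mul_of_nonneg_right hs2.2.le hI0)
    have haI : 8999 / 10000 * inner ℝ u ((Real.sqrt 18)⁻¹ • intVec t : E3) ≤ a * inner ℝ u ((Real.sqrt 18)⁻¹ • intVec t : E3) := mul_le_mul_of_nonneg_right ha9 hI0
    have han : a * ‖d‖ ≤ 103 / 100 * ‖d‖ := mul_le_mul_of_nonneg_right ha1 hd0
    have hlo := (abs_le.1 herr).1
    show (139 : ℝ) / 250 * ‖d‖ ≤ inner ℝ (f ((Real.sqrt 18)⁻¹ • intVec t) - x) d
    rw [hsplit]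
    linarith

/-! ## §2 Charts with transfer, and two steps (lens-3 part III §1 at the shadow dials) -/

/-- **Charts of an all-good set.**  If every point of `Y` is `(1/15, 8999/10000, 103/100)`-two-shell-good, then
`Y` carries integer charts `(Pc, nb)` — pattern `fcc3Int`/`hcpInt`, labelling bijective onto the
`(0, 28/25]`-bonded neighbours, exact links — with label TRANSFER across bonds (the hypothesis `hch` of
`Clean.transportSystem_of_connected`), and every site has a bonded neighbour in every direction at
cosine `≥ 139/250` (the hypothesis `hdir` of `CleanHull.clean_exists_step`). [cite: HalesDSP2012, §1.3] -/
theorem charts {Y : Set E3} (hY : ∀ q ∈ Y, IsTwoShellGoodSet (1 / 15) (8999 / 10000) (103 / 100) Y q) :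
    ∃ (Pc : E3 → Finset (Fin 3 → ℤ)) (nb : E3 → (Fin 3 → ℤ) → E3),
      ((∀ z ∈ Y, (Pc z = fcc3Int ∨ Pc z = hcpInt) ∧
          Set.BijOn (nb z) (↑(Pc z) : Set (Fin 3 → ℤ)) {y | y ∈ Y ∧ (0 < dist z y ∧ dist z y ≤ 28 / 25)} ∧
          (∀ t ∈ Pc z, ∀ t' ∈ Pc z, ((0 < dist (nb z t) (nb z t') ∧ dist (nb z t) (nb z t') ≤ 28 / 25) ↔
            sqNormInt (t - t') = 18))) ∧
        (∀ x ∈ Y, ∀ y ∈ Y, (0 < dist x y ∧ dist x y ≤ 28 / 25) →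
          ∀ t ∈ Pc x, ∀ t' ∈ Pc x, ∀ u ∈ Pc y, ∀ u' ∈ Pc y,
            nb y u = nb x t → nb y u' = nb x t' → sqNormInt (u - u') = sqNormInt (t - t'))) ∧
      (∀ x ∈ Y, ∀ d : E3, ∃ y ∈ Y, y ≠ x ∧ dist x y ≤ 28 / 25 ∧ 139 / 250 * ‖d‖ ≤ inner ℝ (y - x) d) := by
  classical
  choose! L nb hL hbij hA hlink hdir using fun x (hx : x ∈ Y) => intChart hY hx
  refine ⟨L, nb, ⟨fun z hz => ⟨hL z hz, hbij z hz, hlink z hz⟩, ?_⟩, ?_⟩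
  · intro x hx y hy hxy t ht t' ht' u hu u' hu' hut hut'
    obtain ⟨A, hclx⟩ := hA x hx
    obtain ⟨A', hcly⟩ := hA y hy
    exact CleanHull.transfer_of_close (by norm_num) hx hy hxy (hL x hx) (hbij x hx) hclx (hlink x hx) (hL y hy)
      (hbij y hy) hcly (hlink y hy) ht ht' hu hu' hut hut'
  · intro x hx d
    obtain ⟨t, ht, h⟩ := hdir x hx d
    have hm := (hbij x hx).mapsTo (Finset.mem_coe.2 ht)
    refine ⟨nb x t, hm.1, fun h' => ?_, hm.2.2, h⟩
    have := hm.2.1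
    rw [h', dist_self] at this
    exact lt_irrefl _ this

/-- Targets within `134/100` are two steps away in the window graph. [cite: HalesDSP2012, §1.3] -/
theorem loc_walk {Y : Set E3} (hY : ∀ q ∈ Y, IsTwoShellGoodSet (1 / 15) (8999 / 10000) (103 / 100) Y q) :
    ∀ x ∈ Y, ∀ z ∈ Y, dist x z ≤ 134 / 100 → ∃ w : (windowGraph Y).Walk x z, w.length ≤ 2 := by
  intro x hx z hz hd
  by_cases hxz : x = z
  · subst hxz
    exact ⟨SimpleGraph.Walk.nil, by simp⟩
  rcases two_step hY hx hz hxz hd with ⟨-, hle⟩ | ⟨y, hy, ⟨h1, h1'⟩, ⟨h2, h2'⟩⟩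
  · exact ⟨SimpleGraph.Walk.cons (CleanHull.clean_adj_of_dist_le hx hz hxz hle) SimpleGraph.Walk.nil, by simp⟩
  · have hxy : x ≠ y := fun h => by rw [h, dist_self] at h1; exact lt_irrefl _ h1
    have hyz : y ≠ z := fun h => by rw [h, dist_self] at h2; exact lt_irrefl _ h2
    exact ⟨SimpleGraph.Walk.cons (CleanHull.clean_adj_of_dist_le hx hy hxy h1')
      (SimpleGraph.Walk.cons (CleanHull.clean_adj_of_dist_le hy hz hyz h2') SimpleGraph.Walk.nil), by simp⟩

end Summit.AtomisticToContinuum.Crystallization.Theorems.ChartedZeroExcessLayeredLatticeLiouville.ShadowGluing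

end
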